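import Summits.ResolutionOfSingularities.ResolutionOfSingularities.Theorems.LossShear
import Mathlib.Algebra.Polynomial.Taylor
import HarnessLib

/-!
# LossTaylor — the shear of a wall letter is a TAYLOR SHIFT on every line of the support, and a Taylor shift by a
nonzero parameter lowers the order at the origin to at most `degree − (wall)`

decomp-res-lens-3, gen 28 (NODE-g28 §6.8: F21 step (C) of the desk proof of the loss→entry law; kernel plan S6).  TOOLS at 0.
[CJS2020] = Cossart–Jannsen–Saito, arXiv:0905.2191 = LNM 2270, proof of Lemma 13.3 (Lemma 232): after the coordinate change
`u_i ↦ u_i + φ·u_j` the restriction of the equation to a line `{u_i^a u_j^{S−a} u_l^c : a ≤ S}` of monomials is the shifted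
one-variable polynomial `g(u + φ)`.

* §1 `natTrailingDegree_taylor_add_le` — univariate: `g ≠ 0`, `X^k ∣ g`, `φ ≠ 0` ⇒ `ord₀ g(X+φ) + k ≤ deg g`
  (if `X^{μ}` divides `g(X+φ)` then `g = (X−φ)^{μ}·h(X−φ)` and `X^k`, coprime to `(X−φ)^{μ}`, divides `h(X−φ)` of degree `deg g − μ`).
* §2 `lineExp`, `linePoly`, `coeff_linePoly`, `linePoly_shear` — the line polynomial of a trivariate polynomial and the identity
  `linePoly (shear i j φ F) = taylor φ (linePoly F)` (binomial theorem, `LossShear.shear_monomial`).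
* §3 `exists_coeff_shear_ne_zero_le` — on a line whose monomials all have `i`-exponent `≥ k` and `≤ a⋆`, the sheared polynomial
  (`φ ≠ 0`) has a monomial with `i`-exponent `a` satisfying `a + k ≤ a⋆`.
* §4 `cast_sub_wall_le`, `add_wall_le_degree` — the SOURCE BOUND (step (D) of NODE-g28 §6.8 F21): a polygon monomial has
  `D i − r i ≤ (1 − α)(s − D l) + (deg D − r i − r j − s)`; an apex-layer monomial has `D i + r j + s ≤ deg D`.
* §5 `exists_coeff_two_shears_ne_zero_le` — after the two shears of a loss move (`u_l ↦ u_l + λu_j`, then `u_i ↦ u_i + φu_j`,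
  `φ ≠ 0`) every inhabited line `(S, c)` carries a monomial with `i`-exponent `≤ B − k`, `B` = any bound on the `i`-exponents
  of the sources (monomials of `F` of degree `S + c` with `l`-exponent `≥ c`).
-/

open MvPolynomial Finset
open Literature.AlgebraicGeometry.Resolution
open Literature.AlgebraicGeometry.Resolution.Hauser2010
open Literature.AlgebraicGeometry.Resolution.PointBlowup
open Summit.ResolutionOfSingularities.ResolutionOfSingularities.Theorems.LossExitCone

namespace Summit.ResolutionOfSingularities.ResolutionOfSingularities.Theorems.LossPolygon

variable {K : Type} [Field K]

section TaylorOrder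

/-! ## §1 Univariate: the order at the origin of a Taylor shift -/

/-- **ORDER OF A TAYLOR SHIFT (PROVED):** if `g ≠ 0`, `X^k ∣ g` and `φ ≠ 0`, then the lowest exponent of `g(X + φ)` is at most
`deg g − k`. [folklore; CJS2020 proof of Lemma 13.3, «u_i^k divides and the translation is nonzero»] -/
theorem natTrailingDegree_taylor_add_le (g : Polynomial K) (hg : g ≠ 0) {k : ℕ} (hk : Polynomial.X ^ k ∣ g) {φ : K}
    (hφ : φ ≠ 0) : (Polynomial.taylor φ g).natTrailingDegree + k ≤ g.natDegree := by
  set h := Polynomial.taylor φ g with hh_def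
  have hh0 : h ≠ 0 := fun h0 => hg ((Polynomial.taylor_eq_zero (r := φ) (f := g)).mp h0)
  set μ := h.natTrailingDegree with hμ_def
  -- `X^μ ∣ h`
  have hμ : Polynomial.X ^ μ ∣ h :=
    Polynomial.X_pow_dvd_iff.mpr fun d hd => Polynomial.coeff_eq_zero_of_lt_natTrailingDegree hd
  obtain ⟨h₁, hh₁⟩ := hμ
  have hh₁0 : h₁ ≠ 0 := by
    rintro rfl; exact hh0 (by rw [hh₁, mul_zero])
  -- shift back: `g = (X − φ)^μ · h₁(X − φ)`
  have h1 : Polynomial.taylor (-φ) h = g := by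
    rw [hh_def, Polynomial.taylor_taylor, neg_add_cancel, Polynomial.taylor_zero]
  have hback : g = (Polynomial.X + Polynomial.C (-φ)) ^ μ * Polynomial.taylor (-φ) h₁ := by
    rw [← h1, hh₁, Polynomial.taylor_mul, Polynomial.taylor_pow, Polynomial.taylor_X]
  -- `X^k` is coprime to `(X − φ)^μ`
  have hcop : IsCoprime (Polynomial.X ^ k : Polynomial K) ((Polynomial.X + Polynomial.C (-φ)) ^ μ) := by
    have h0 : IsCoprime (Polynomial.X - Polynomial.C (0 : K)) (Polynomial.X - Polynomial.C φ) :=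
      Polynomial.isCoprime_X_sub_C_of_isUnit_sub (by rw [zero_sub]; exact (neg_ne_zero.mpr hφ).isUnit)
    rw [map_zero, sub_zero, sub_eq_add_neg, ← map_neg] at h0
    exact h0.pow
  have hdvd : (Polynomial.X ^ k : Polynomial K) ∣ Polynomial.taylor (-φ) h₁ :=
    hcop.dvd_of_dvd_mul_left (hback ▸ hk)
  have ht0 : Polynomial.taylor (-φ) h₁ ≠ 0 := fun h0 => hh₁0 ((Polynomial.taylor_eq_zero (r := -φ) (f := h₁)).mp h0)
  have hk' : k ≤ h₁.natDegree := by
    have := Polynomial.natDegree_le_of_dvd hdvd ht0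
    rwa [Polynomial.natDegree_X_pow, Polynomial.natDegree_taylor] at this
  have hdeg : g.natDegree = μ + h₁.natDegree := by
    rw [← Polynomial.natDegree_taylor g φ, ← hh_def, hh₁,
      Polynomial.natDegree_mul (pow_ne_zero _ Polynomial.X_ne_zero) hh₁0, Polynomial.natDegree_X_pow]
  omega

end TaylorOrder

section Line

variable {i j l : Fin 3}

/-! ## §2 The line polynomial and the Taylor identity for the shear of a wall letter -/

/-- The exponent `u_i^a u_j^{S−a} u_l^c` of the line `(S, c)`. [new] -/
noncomputable def lineExp (i j l : Fin 3) (S c a : ℕ) : Fin 3 →₀ ℕ :=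
  Finsupp.single i a + Finsupp.single j (S - a) + Finsupp.single l c

/-- `lineExp_apply_fst`: the `i`-exponent. [new; elementary] -/
theorem lineExp_apply_fst (hij : i ≠ j) (hil : i ≠ l) (S c a : ℕ) : lineExp i j l S c a i = a := by
  simp [lineExp, hij.symm, hil.symm]

/-- `lineExp_apply_snd`: the `j`-exponent. [new; elementary] -/
theorem lineExp_apply_snd (hij : i ≠ j) (hjl : j ≠ l) (S c a : ℕ) : lineExp i j l S c a j = S - a := by
  simp [lineExp, hij, hjl.symm]

/-- `lineExp_apply_thd`: the `l`-exponent. [new; elementary] -/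
theorem lineExp_apply_thd (hil : i ≠ l) (hjl : j ≠ l) (S c a : ℕ) : lineExp i j l S c a l = c := by
  simp [lineExp, hil, hjl]

/-- `lineExp` is injective in `a ≤ S`. [new; elementary] -/
theorem lineExp_injOn (hij : i ≠ j) (hil : i ≠ l) (S c : ℕ) {a a' : ℕ} (h : lineExp i j l S c a = lineExp i j l S c a') :
    a = a' := by
  have := congrArg (fun E => E i) h
  simpa [lineExp_apply_fst hij hil] using this

/-- An exponent `D` lies on the line `(S, c)` iff it is `lineExp S c (D i)` — letterwise criterion. [new; elementary] -/
theorem lineExp_eq_iff (hij : i ≠ j) (hil : i ≠ l) (hjl : j ≠ l) (S c a : ℕ) (D : Fin 3 →₀ ℕ) :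
    lineExp i j l S c a = D ↔ D i = a ∧ D j = S - a ∧ D l = c := by
  constructor
  · rintro rfl
    exact ⟨lineExp_apply_fst hij hil S c a, lineExp_apply_snd hij hjl S c a, lineExp_apply_thd hil hjl S c a⟩
  · rintro ⟨h1, h2, h3⟩
    rw [finsupp_fin3_eq hij hil hjl D, h1, h2, h3]
    rfl

/-- The LINE POLYNOMIAL of `F` on the line `(S, c)`: `Σ_{a ≤ S} coeff_{(a, S−a, c)}(F) · X^a`. [new object; CJS2020 §13 «restriction to a line»] -/
noncomputable def linePoly (i j l : Fin 3) (S c : ℕ) (F : MvPolynomial (Fin 3) K) : Polynomial K :=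
  ∑ a ∈ Finset.range (S + 1), Polynomial.monomial a (coeff (lineExp i j l S c a) F)

/-- **COEFFICIENTS OF THE LINE POLYNOMIAL (PROVED).** [new; elementary] -/
theorem coeff_linePoly (S c : ℕ) (F : MvPolynomial (Fin 3) K) (a : ℕ) :
    (linePoly i j l S c F).coeff a = if a ≤ S then coeff (lineExp i j l S c a) F else 0 := by
  unfold linePoly
  rw [Polynomial.finsetSum_coeff]
  simp_rw [Polynomial.coeff_monomial]
  rw [Finset.sum_ite_eq' (Finset.range (S + 1)) a]
  simp only [Finset.mem_range, Nat.lt_succ_iff]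

/-- `linePoly` is additive. [new; elementary] -/
theorem linePoly_add (S c : ℕ) (F G : MvPolynomial (Fin 3) K) :
    linePoly i j l S c (F + G) = linePoly i j l S c F + linePoly i j l S c G := by
  unfold linePoly
  rw [← Finset.sum_add_distrib]
  refine Finset.sum_congr rfl fun a _ => ?_
  rw [coeff_add, map_add]

/-- The line polynomial of a monomial: `r·X^{D i}` if `D` lies on the line, else `0`. [new; elementary] -/
theorem linePoly_monomial (hij : i ≠ j) (hil : i ≠ l) (hjl : j ≠ l) (S c : ℕ) (D : Fin 3 →₀ ℕ) (r : K) :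
    linePoly i j l S c (monomial D r) =
      if D j + D i = S ∧ D l = c then Polynomial.monomial (D i) r else 0 := by
  classical
  unfold linePoly
  simp_rw [coeff_monomial]
  by_cases hD : D j + D i = S ∧ D l = c
  · rw [if_pos hD, Finset.sum_eq_single_of_mem (D i) (Finset.mem_range.mpr (by omega))]
    · rw [if_pos ((lineExp_eq_iff hij hil hjl S c (D i) D).mpr ⟨rfl, by omega, hD.2⟩).symm]
    · intro a ha hne
      rw [if_neg, map_zero]
      intro h
      have h1 := ((lineExp_eq_iff hij hil hjl S c a D).mp h.symm).1
      exact hne h1.symm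
  · rw [if_neg hD]
    refine Finset.sum_eq_zero fun a ha => ?_
    rw [if_neg, map_zero]
    intro h
    have haS : a ≤ S := Nat.lt_succ_iff.mp (Finset.mem_range.mp ha)
    obtain ⟨h1, h2, h3⟩ := (lineExp_eq_iff hij hil hjl S c a D).mp h.symm
    exact hD ⟨by omega, h3⟩

/-- Taylor shift of a univariate monomial, binomially expanded and indexed by the number of converted letters. [folklore] -/
theorem taylor_monomial_eq_sum (φ r : K) (N : ℕ) :
    Polynomial.taylor φ (Polynomial.monomial N r) =
      ∑ n ∈ Finset.range (N + 1), Polynomial.monomial (N - n) (r * φ ^ n * (N.choose n : K)) := by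
  rw [Polynomial.taylor_monomial, add_pow, Finset.mul_sum]
  rw [← Finset.sum_range_reflect]
  refine Finset.sum_congr rfl fun n hn => ?_
  have hn' : n ≤ N := Nat.lt_succ_iff.mp (Finset.mem_range.mp hn)
  rw [show N + 1 - 1 - n = N - n from by omega, show N - (N - n) = n from by omega, Nat.choose_symm hn',
    ← map_pow, ← Polynomial.C_mul_X_pow_eq_monomial, ← map_natCast Polynomial.C (N.choose n), map_mul, map_mul]
  ring

/-- **THE SHEAR OF A WALL LETTER IS A TAYLOR SHIFT ON EVERY LINE (PROVED):**
`linePoly (σ_{i,j,φ} F) = (linePoly F)(X + φ)` for `σ_{i,j,φ} : u_i ↦ u_i + φ·u_j`. [CJS2020 proof of Lemma 13.3 (Lemma 232); for the walk's shear: new] -/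
theorem linePoly_shear (hij : i ≠ j) (hil : i ≠ l) (hjl : j ≠ l) (φ : K) (S c : ℕ) (F : MvPolynomial (Fin 3) K) :
    linePoly i j l S c (shear i j φ F) = Polynomial.taylor φ (linePoly i j l S c F) := by
  classical
  induction F using MvPolynomial.induction_on' with
  | monomial D r =>
    rw [shear_monomial hjl hij.symm hil.symm φ D r, linePoly_monomial hij hil hjl]
    -- the line polynomial of the binomial expansion, summand by summand
    have hsum : linePoly i j l S c (∑ n ∈ Finset.range (D i + 1), monomial (shearExp j l i D n) (r * φ ^ n * ((D i).choose n : K))) =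
        ∑ n ∈ Finset.range (D i + 1), linePoly i j l S c (monomial (shearExp j l i D n) (r * φ ^ n * ((D i).choose n : K))) := by
      induction Finset.range (D i + 1) using Finset.induction_on with
      | empty => simp [linePoly]
      | insert x t hx ih => rw [Finset.sum_insert hx, Finset.sum_insert hx, linePoly_add, ih]
    rw [hsum]
    split_ifs with hD
    · rw [taylor_monomial_eq_sum]
      refine Finset.sum_congr rfl fun n hn => ?_
      have hn' : n ≤ D i := Nat.lt_succ_iff.mp (Finset.mem_range.mp hn)
      rw [linePoly_monomial hij hil hjl, shearExp_apply_fst hjl hij.symm, shearExp_apply_thd hij.symm hil.symm,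
        shearExp_apply_snd hjl hil.symm, if_pos ⟨by omega, hD.2⟩]
    · refine (Finset.sum_eq_zero fun n hn => ?_).trans (map_zero _).symm
      have hn' : n ≤ D i := Nat.lt_succ_iff.mp (Finset.mem_range.mp hn)
      rw [linePoly_monomial hij hil hjl, shearExp_apply_fst hjl hij.symm, shearExp_apply_thd hij.symm hil.symm,
        shearExp_apply_snd hjl hil.symm, if_neg]
      intro h; exact hD ⟨by omega, h.2⟩
  | add F G hF hG => rw [map_add, linePoly_add, linePoly_add, map_add, hF, hG]

/-! ## §3 The lowest `i`-exponent on a line after the shear -/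

/-- **LOWEST TERM OF A SHEARED LINE (PROVED):** if on the line `(S, c)` the polynomial `F` has a monomial, all its monomials have
`i`-exponent `≥ k` (the wall `u_i^k` divides) and `≤ a⋆`, and `φ ≠ 0`, then `σ_{i,j,φ} F` has on that line a monomial with
`i`-exponent `a`, `a + k ≤ a⋆`. [CJS2020 proof of Lemma 13.3; for the walk: new] -/
theorem exists_coeff_shear_ne_zero_le (hij : i ≠ j) (hil : i ≠ l) (hjl : j ≠ l) {φ : K} (hφ : φ ≠ 0) (S c k aStar : ℕ)
    (F : MvPolynomial (Fin 3) K) (hne : ∃ a, a ≤ S ∧ coeff (lineExp i j l S c a) F ≠ 0)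
    (hk : ∀ a, a ≤ S → coeff (lineExp i j l S c a) F ≠ 0 → k ≤ a)
    (htop : ∀ a, a ≤ S → coeff (lineExp i j l S c a) F ≠ 0 → a ≤ aStar) :
    ∃ a, a + k ≤ aStar ∧ a ≤ S ∧ coeff (lineExp i j l S c a) (shear i j φ F) ≠ 0 := by
  set g := linePoly i j l S c F with hg_def
  have hg0 : g ≠ 0 := by
    obtain ⟨a, haS, ha⟩ := hne
    intro h0
    have := congrArg (fun p => Polynomial.coeff p a) h0
    simp only [hg_def, coeff_linePoly, if_pos haS, Polynomial.coeff_zero] at this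
    exact ha this
  have hXk : Polynomial.X ^ k ∣ g := by
    refine Polynomial.X_pow_dvd_iff.mpr fun d hd => ?_
    rw [hg_def, coeff_linePoly]
    split_ifs with hdS
    · by_contra h; exact absurd (hk d hdS h) (by omega)
    · rfl
  have hdeg : g.natDegree ≤ aStar := by
    refine Polynomial.natDegree_le_iff_coeff_eq_zero.mpr fun N hN => ?_
    rw [hg_def, coeff_linePoly]
    split_ifs with hNS
    · by_contra h; exact absurd (htop N hNS h) (by omega)
    · rfl
  have hμ := natTrailingDegree_taylor_add_le g hg0 hXk hφ
  set μ := (Polynomial.taylor φ g).natTrailingDegree with hμ_def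
  have hcoef : (Polynomial.taylor φ g).coeff μ ≠ 0 := by
    have : (Polynomial.taylor φ g).trailingCoeff ≠ 0 :=
      mt Polynomial.trailingCoeff_eq_zero.mp fun h0 => hg0 ((Polynomial.taylor_eq_zero (r := φ) (f := g)).mp h0)
    exact this
  rw [hg_def, ← linePoly_shear hij hil hjl, coeff_linePoly] at hcoef
  split_ifs at hcoef with hμS
  · exact ⟨μ, by omega, hμS, hcoef⟩
  · exact absurd rfl hcoef


/-! ## §4 The source bound: a polygon monomial's run-wall excess is controlled by `α` and the degree excess -/

/-- A support exponent below the ceiling carries a point of `polyPts`. [new; elementary] -/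
theorem resPoint_mem_polyPts (s : ℕ) (r : Fin 3 →₀ ℕ) (a b c : Fin 3) (F : MvPolynomial (Fin 3) K)
    {D : Fin 3 →₀ ℕ} (hD : D ∈ F.support) (hDc : D c < s + r c) : resPoint s r a b c D ∈ polyPts s r a b c F :=
  Finset.mem_image.mpr ⟨D, Finset.mem_filter.mpr ⟨hD, hDc⟩, rfl⟩

/-- **SOURCE BOUND, polygon half (PROVED):** in the frame `(j, i ; l)` with free letter `l` (`r l = 0`), every monomial `u^D` of
`F` below the ceiling (`D l < s`) satisfies `D i − r i ≤ (1 − α)·(s − D l) + (deg D − r i − r j − s)`, because its point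
`(x, y)` has `x ≥ α` and `x + y = 1 + (deg D − r i − r j − s)/(s − D l)`. [CJS2020 §13 geometry of `Δ`; for the walk: new] -/
theorem cast_sub_wall_le (hij : i ≠ j) (hil : i ≠ l) (hjl : j ≠ l) (s : ℕ) (r : Fin 3 →₀ ℕ) (hrl : r l = 0)
    (F : MvPolynomial (Fin 3) K) {D : Fin 3 →₀ ℕ} (hD : D ∈ F.support) (hDl : D l < s) :
    ((D i : ℕ) : ℚ) - r i ≤
      (1 - alphaOf (polyPts s r j i l F)) * (((s : ℕ) : ℚ) - D l) + ((((D.degree : ℕ) : ℚ)) - r i - r j - s) := by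
  have hmem : resPoint s r j i l D ∈ polyPts s r j i l F :=
    resPoint_mem_polyPts s r j i l F hD (by rw [hrl]; omega)
  have hα := alphaOf_le_fst hmem
  simp only [resPoint, hrl, Nat.cast_zero, add_zero] at hα
  have hlt : ((D l : ℕ) : ℚ) < s := by exact_mod_cast hDl
  have hpos : (0 : ℚ) < ((s : ℕ) : ℚ) - D l := by linarith
  have h1 : alphaOf (polyPts s r j i l F) * (((s : ℕ) : ℚ) - D l) ≤ ((D j : ℕ) : ℚ) - r j := by
    rwa [le_div_iff₀ hpos] at hα
  have hdeg : ((D.degree : ℕ) : ℚ) = D i + D j + D l := by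
    rw [degree_fin3 hij hil hjl D]; push_cast; ring
  rw [hdeg]
  nlinarith [h1]

/-- **SOURCE BOUND, apex half (PROVED):** a monomial above the ceiling (`s ≤ D l`) that respects the loss wall (`r j ≤ D j`) has
`D i + r j + s ≤ deg D`. [new; elementary] -/
theorem add_wall_le_degree (hij : i ≠ j) (hil : i ≠ l) (hjl : j ≠ l) (s : ℕ) (r : Fin 3 →₀ ℕ) {D : Fin 3 →₀ ℕ}
    (hDj : r j ≤ D j) (hDl : s ≤ D l) : D i + r j + s ≤ D.degree := by
  rw [degree_fin3 hij hil hjl D]; omega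


/-! ## §5 Two shears: the lowest run-wall exponent on a line of `σ_{i,j,φ} σ_{l,j,λ} F` -/

/-- A monomial of `σ_{i,j,φ} F` on the line `(S, c)` forces a monomial of `F` on the same line. [new; elementary] -/
theorem exists_coeff_lineExp_ne_zero_of_shear (hij : i ≠ j) (hil : i ≠ l) (hjl : j ≠ l) (φ : K) (S c : ℕ)
    (F : MvPolynomial (Fin 3) K) {a₀ : ℕ} (ha₀ : a₀ ≤ S) (h : coeff (lineExp i j l S c a₀) (shear i j φ F) ≠ 0) :
    ∃ a, a ≤ S ∧ coeff (lineExp i j l S c a) F ≠ 0 := by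
  by_contra hne
  have hne' : ∀ a, a ≤ S → coeff (lineExp i j l S c a) F = 0 := fun a ha => by
    by_contra h'; exact hne ⟨a, ha, h'⟩
  have h0 : linePoly i j l S c F = 0 := by
    refine Polynomial.ext fun n => ?_
    rw [coeff_linePoly, Polynomial.coeff_zero]
    split_ifs with hn
    · exact hne' n hn
    · rfl
  have h1 : linePoly i j l S c (shear i j φ F) = 0 := by rw [linePoly_shear hij hil hjl, h0, map_zero]
  have := congrArg (fun p => Polynomial.coeff p a₀) h1
  simp only [coeff_linePoly, if_pos ha₀, Polynomial.coeff_zero] at this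
  exact h this

/-- The shear of the FREE letter `l` into `j` keeps the `i`-exponent and does not lower the `l`-exponent of a source:
a monomial `(a, S − a, c)` of `σ_{l,j,λ} F` comes from a monomial `D` of `F` with `D i = a`, `c ≤ D l`, `deg D = S + c`.
[folklore; `exists_shearExp_eq_of_mem_support_shear`] -/
theorem exists_source_of_coeff_lineExp_shear_free (hij : i ≠ j) (hil : i ≠ l) (hjl : j ≠ l) (g : K) (S c : ℕ)
    (F : MvPolynomial (Fin 3) K) {a : ℕ} (ha : a ≤ S) (h : coeff (lineExp i j l S c a) (shear l j g F) ≠ 0) :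
    ∃ D ∈ F.support, D i = a ∧ c ≤ D l ∧ D.degree = S + c := by
  obtain ⟨D, hD, n, hn, hE⟩ :=
    exists_shearExp_eq_of_mem_support_shear hij.symm hjl hil g F (mem_support_iff.mpr h)
  have h1 := congrArg (fun E => E i) hE
  have h2 := congrArg (fun E => E j) hE
  have h3 := congrArg (fun E => E l) hE
  simp only [shearExp_apply_snd hij.symm hil, lineExp_apply_fst hij hil, shearExp_apply_fst hij.symm hjl,
    lineExp_apply_snd hij hjl, shearExp_apply_thd hjl hil, lineExp_apply_thd hil hjl] at h1 h2 h3
  refine ⟨D, hD, h1, by omega, ?_⟩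
  rw [degree_fin3 hij hil hjl D]; omega

/-- **LOWEST RUN-WALL EXPONENT ON A LINE AFTER THE TWO SHEARS OF A LOSS MOVE (PROVED):** let `σF = σ_{i,j,φ}(σ_{l,j,λ} F)` with
`φ ≠ 0` (the run wall `i` IS translated), let `u_i^k` divide `F` monomialwise, and let `B` bound the `i`-exponent of every monomial
of `F` of degree `S + c` with `l`-exponent `≥ c` (the possible SOURCES of the line `(S, c)`).  If `σF` has a monomial on the line
`(S, c)`, then it has one with `i`-exponent `a`, `a + k ≤ B`. [CJS2020 proof of Lemma 13.3 (Lemma 232 + «u^k divides»); for the walk: new] -/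
theorem exists_coeff_two_shears_ne_zero_le (hij : i ≠ j) (hil : i ≠ l) (hjl : j ≠ l) {φ : K} (hφ : φ ≠ 0) (g : K)
    (S c k B : ℕ) (F : MvPolynomial (Fin 3) K) (hwall : ∀ D ∈ F.support, k ≤ D i)
    (hB : ∀ D ∈ F.support, D.degree = S + c → c ≤ D l → D i ≤ B) {a₀ : ℕ} (ha₀ : a₀ ≤ S)
    (h : coeff (lineExp i j l S c a₀) (shear i j φ (shear l j g F)) ≠ 0) :
    ∃ a, a + k ≤ B ∧ a ≤ S ∧ coeff (lineExp i j l S c a) (shear i j φ (shear l j g F)) ≠ 0 := by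
  refine exists_coeff_shear_ne_zero_le hij hil hjl hφ S c k B (shear l j g F)
    (exists_coeff_lineExp_ne_zero_of_shear hij hil hjl φ S c _ ha₀ h) ?_ ?_
  · intro a ha hne
    obtain ⟨D, hD, hDi, -, -⟩ := exists_source_of_coeff_lineExp_shear_free hij hil hjl g S c F ha hne
    rw [← hDi]; exact hwall D hD
  · intro a ha hne
    obtain ⟨D, hD, hDi, hDl, hdeg⟩ := exists_source_of_coeff_lineExp_shear_free hij hil hjl g S c F ha hne
    rw [← hDi]; exact hB D hD hdeg hDl

end Line

end Summit.ResolutionOfSingularities.ResolutionOfSingularities.Theorems.LossPolygon
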